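import Summits.QuantumFields.YangMills.Theorems.FluctuationComparisonRegPrIntLS2BetaChartJacExplicitPointRows
import Summits.QuantumFields.YangMills.Theorems.FluctuationComparisonRegPrIntLS2BetaChartJacProduct
import Summits.QuantumFields.YangMills.Theorems.FluctuationComparisonRegPrIntLS2BetaChartContWindowChart
import HarnessLib

/-!
# S2β · LINE g18-1 · DET-REP-B‴∘ ∕ JACW — (J-PIN) THEOREM OF RECORD: in the window-chart regime, EVERY window chart with the `ChartRows`∕`ChartRowsJ` clauses has,
# at every charted small-field history, the Jacobian value `Π_c jd c U (Ū⁽ᴷ⁻ᴶ⁾U c)` — a PRODUCT OVER THE COARSE BONDS of the per-bond inverse chain densities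

Cell `ym3-torus` (rung R3: continuum `SU(2)` Yang–Mills on `T³` — NOT `d = 4`, NOT infinite volume, NOT a mass gap, NOT Clay); width seat `ym-ust-20520-w5` g16;
helper of the crux `stmt-QuantumFields-20520` (`--supports … --as helper`, NOT a proof of it).  The INSTANTIATION announced in FINDING #41 addendum v2 (evidence #46):
✓p764094 `…ChartJacExplicitPointRows.windowChart_jac_eq_explicit_at` with every hypothesis discharged BY NAME from the lineage, in the regime of ✓`…ChartContWindowChart`
§4 (`exists_chartRegime`, `exists_gamma_forall_θBal_le`, ✓`…Wreg.chartVol`∕`edgeFlat`, ✓IV-c″ `exists_fibredChart_iter_cont_blind_prod` (✓p761834), ✓`graph_mem_nhds`,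
✓`fibredLaw_transport`, ✓`histGood_subset_charted`, ✓`closure_histGood_subset_loopSmall_lt`, ✓`isOpen_histGood`) and the product read off by ✓`jac_apply_eq_prod_of_mem`.
★★★`exists_chainData_forall_windowChart_jac_eq_prod`: for every block size and thresholds `b₀, p₀ > 0` there is `γ₁ > 0` such that for every family of that block size,
coupling `γ ≤ γ₁`, and `J ≤ K`, THERE ARE chain data `(T, ϑ, jd)` of depth `K − J` with ✓IV-b's eighteen rows (at a chart level `α` and volume constant `j₀` also
exported) such that for EVERY `c : WindowChart F hJK (histGood θBal K J) {PlaqSmall (θBal J)}` satisfying the off-pivot identity on its live set and pivot-blindness of its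
Jacobian, and EVERY window datum `V₀` and charted small-field history `U ∈ histGood` over it at which `c` carries the four `ChartRows` clauses:
`(c.jac (V₀, U) : ℝ≥0∞) = Π_{c′} jd c′ U (Ū⁽ᴷ⁻ᴶ⁾ U c′)`.  This is the JACW hand's (J-LOC)+(J-PIN) input BY NAME; what it still owes is (J-LIP)∘(J-BRD) into ✓p761050.
HONEST SCOPE.  Plumbing over landed theorems (zero new mathematics); def-free; default heartbeats; proves nothing of BRD, (J-LIP), DETN∕JACW's value bound, DET-REP-B‴∘,
S2β or the crux 20520; `YM3TorusSU2` NOT proved; the Yang–Mills mass gap (Clay) NOT proved.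
[cite: Balaban1987RG1, (0.4) p.253, (2.4) p.266 and (2.10) p.267] [cite: Bogachev2007, Thm 2.5.3]
-/

set_option autoImplicit false

noncomputable section

open MeasureTheory Filter Topology Set Function
open scoped ENNReal NNReal
open Literature.MathematicalPhysics.QuantumFieldTheory.Balaban1983to89
open Literature.MathematicalPhysics.QuantumFieldTheory.Balaban1983to89.T3ContinuumYM3Torus
open Literature.MathematicalPhysics.QuantumFieldTheory.Balaban1983to89.T3NestedUnitLaws
open Literature.MathematicalPhysics.QuantumFieldTheory.Balaban1983to89.T3UnitLawDensityEML
open Literature.MathematicalPhysics.QuantumFieldTheory.Balaban1983to89.T3UnitScaleTilt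
open Literature.MathematicalPhysics.QuantumFieldTheory.Balaban1983to89.T3TiltDescent
open Literature.MathematicalPhysics.QuantumFieldTheory.Balaban1983to89.T3PrintedRegularMinimiser
open Literature.MathematicalPhysics.QuantumFieldTheory.Balaban1983to89.T3LevelShift
open Literature.MathematicalPhysics.QuantumFieldTheory.Balaban1983to89.T3Thresholds
open Literature.MathematicalPhysics.QuantumFieldTheory.Balaban1983to89.T4Continuum
open scoped Literature.MathematicalPhysics.QuantumFieldTheory.Balaban1983to89.T3OrbitAverage

namespace Summit.QuantumFields.YangMills.Theorems.FluctuationComparisonRegPrIntLS2BetaChartJacPinnedOfRecord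

open Summit.QuantumFields.YangMills.Theorems.FluctuationComparisonRegPrIntLWregChain
open Summit.QuantumFields.YangMills.Theorems.FluctuationComparisonRegPrIntLWregFibredChart (fibredLaw_transport)
open Summit.QuantumFields.YangMills.Theorems.FluctuationComparisonRegPrIntLWregAssembly (exists_chartRegime histGood_subset_charted isOpen_setOf_plaqSmall₂)
open Summit.QuantumFields.YangMills.Theorems.FluctuationComparisonRegPrIntLWregInterior (isOpen_histGood)
open Summit.QuantumFields.YangMills.Theorems.FluctuationComparisonRegPrIntLS2BetaChartContClosedProfile (closure_histGood_subset_loopSmall_lt)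
open Summit.QuantumFields.YangMills.Theorems.FluctuationComparisonRegPrIntLS2BetaChartContCarrierNhds (graph_mem_nhds)
open Summit.QuantumFields.YangMills.Theorems.FluctuationComparisonRegPrIntLS2BetaChartJacProduct (exists_fibredChart_iter_cont_blind_prod jac_apply_eq_prod_of_mem)
open Summit.QuantumFields.YangMills.Theorems.FluctuationComparisonRegPrIntLS2BetaChartJacExplicitPointRows (windowChart_jac_eq_explicit_at)
open Literature.MathematicalPhysics.QuantumFieldTheory.Balaban1983to89.BlockAveraging (Idx loopHol)
open Literature.MathematicalPhysics.QuantumFieldTheory.Balaban1983to89.BlockAveragingEMLHaarAC (offCard)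
open Literature.MathematicalPhysics.QuantumFieldTheory.Balaban1983to89.ExpMeanLog (deltaSU)

/-- ★★★ **(J-PIN) THEOREM OF RECORD — THE WINDOW CHART'S JACOBIAN AT A CHARTED SMALL-FIELD HISTORY IS THE PRODUCT OF THE INVERSE CHAIN DENSITIES, FOR EVERY WINDOW
CHART WITH THE ROWS.**  See the module docstring.  The four `ChartRows` clauses of `c` at `(V₀, U)` and its two global clauses (off-pivot identity on the live set,
pivot-blind Jacobian; pivots `iterCentralBond (K − J)`) are hypotheses in the tree's letters; everything on the explicit side is discharged by name.
[cite: Balaban1987RG1, (0.4) p.253, (2.4) p.266 and (2.10) p.267] [cite: Bogachev2007, Thm 2.5.3] -/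
theorem exists_chainData_forall_windowChart_jac_eq_prod :
    ∀ (L : ℕ) (b₀ p₀ : ℝ), 0 < b₀ → 0 < p₀ → ∃ γ₁ : ℝ, 0 < γ₁ ∧ ∀ (F : T3Family) (γ : ℝ), F.L = L → 0 < γ → γ ≤ γ₁ →
      ∀ (J K : ℕ) (hJK : J ≤ K),
        ∃ (α : ℝ) (j₀ : ℝ≥0) (T : PBond (F.P K) (K - J) → GaugeField (F.P K) 0 (Matrix.specialUnitaryGroup (Fin 2) ℂ) → Set (Matrix.specialUnitaryGroup (Fin 2) ℂ))
          (ϑ : PBond (F.P K) (K - J) → GaugeField (F.P K) 0 (Matrix.specialUnitaryGroup (Fin 2) ℂ) → Matrix.specialUnitaryGroup (Fin 2) ℂ → Matrix.specialUnitaryGroup (Fin 2) ℂ)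
          (jd : PBond (F.P K) (K - J) → GaugeField (F.P K) 0 (Matrix.specialUnitaryGroup (Fin 2) ℂ) → Matrix.specialUnitaryGroup (Fin 2) ℂ → ℝ≥0),
          (0 < α ∧ α ≤ 1 / 24 ∧ 64 * α ≤ deltaSU (Fin 2) ∧ 157 * α < (((F.P K).L : ℝ) ^ ((F.P K).d - 1))⁻¹ ∧
            (∀ j (c : PBond (F.P K) (j + 1)), (offCard c : ℝ) / (Fintype.card (Idx (F.P K)) : ℝ) + 150 * α < 1) ∧ 0 < j₀) ∧ (
          (∀ c, MeasurableSet {p : GaugeField (F.P K) 0 (Matrix.specialUnitaryGroup (Fin 2) ℂ) × Matrix.specialUnitaryGroup (Fin 2) ℂ | p.2 ∈ T c p.1}) ∧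
          (∀ c, Measurable fun p : GaugeField (F.P K) 0 (Matrix.specialUnitaryGroup (Fin 2) ℂ) × Matrix.specialUnitaryGroup (Fin 2) ℂ => ϑ c p.1 p.2) ∧
          (∀ c, Measurable fun p : GaugeField (F.P K) 0 (Matrix.specialUnitaryGroup (Fin 2) ℂ) × Matrix.specialUnitaryGroup (Fin 2) ℂ => jd c p.1 p.2) ∧
          (∀ c U, ∀ v ∈ T c U, chainMap ℰp (K - J) U c (ϑ c U v) = v) ∧
          (∀ c U, (HaarData.haar : Measure (Matrix.specialUnitaryGroup (Fin 2) ℂ)).restrict (chainWindow (N := 2) α (K - J) U c) =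
            (((HaarData.haar : Measure (Matrix.specialUnitaryGroup (Fin 2) ℂ)).restrict (T c U)).withDensity fun v => (jd c U v : ℝ≥0∞)).map (ϑ c U)) ∧
          (∀ c U, T c U = chainMap ℰp (K - J) U c '' chainWindow (N := 2) α (K - J) U c) ∧
          (∀ c U, ∀ g ∈ chainWindow (N := 2) α (K - J) U c, ϑ c U (chainMap ℰp (K - J) U c g) = g) ∧
          (∀ c U, ∀ v ∈ T c U, ϑ c U v ∈ chainWindow (N := 2) α (K - J) U c) ∧
          (∀ c U, IsClosed (T c U)) ∧
          (∀ c U, ContinuousOn (ϑ c U) (T c U)) ∧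
          (∀ c U, ContinuousOn (jd c U) (T c U)) ∧
          (∀ c U, ∀ v ∈ T c U, jd c U v ≠ 0) ∧
          (∀ c U, ∀ v ∈ T c U, j₀ ^ (K - J) * jd c U v ≤ 1) ∧
          (∀ c, ContinuousOn (fun p : GaugeField (F.P K) 0 (Matrix.specialUnitaryGroup (Fin 2) ℂ) × Matrix.specialUnitaryGroup (Fin 2) ℂ => ϑ c p.1 p.2)
            {p : GaugeField (F.P K) 0 (Matrix.specialUnitaryGroup (Fin 2) ℂ) × Matrix.specialUnitaryGroup (Fin 2) ℂ |
              (∀ k, k < K - J → ∀ (c' : PBond (F.P K) (k + 1)) (i : Idx (F.P K)),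
                dist1 (loopHol (Averaging.iter (fun i => BlockAveraging.blockAvg (P := F.P K) (j := i) ℰp) k p.1) c' i) ≤ α) ∧
              p.2 ∈ T c p.1}) ∧
          (∀ c, ContinuousOn (fun p : GaugeField (F.P K) 0 (Matrix.specialUnitaryGroup (Fin 2) ℂ) × Matrix.specialUnitaryGroup (Fin 2) ℂ => jd c p.1 p.2)
            {p : GaugeField (F.P K) 0 (Matrix.specialUnitaryGroup (Fin 2) ℂ) × Matrix.specialUnitaryGroup (Fin 2) ℂ |
              (∀ k, k < K - J → ∀ (c' : PBond (F.P K) (k + 1)) (i : Idx (F.P K)),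
                dist1 (loopHol (Averaging.iter (fun i => BlockAveraging.blockAvg (P := F.P K) (j := i) ℰp) k p.1) c' i) ≤ α) ∧
              p.2 ∈ T c p.1}) ∧
          (∀ c U (g : PBond (F.P K) (K - J) → Matrix.specialUnitaryGroup (Fin 2) ℂ), T c (extend (iterCentralBond (K - J)) g U) = T c U) ∧
          (∀ c U (g : PBond (F.P K) (K - J) → Matrix.specialUnitaryGroup (Fin 2) ℂ), ∀ v ∈ T c U, ϑ c (extend (iterCentralBond (K - J)) g U) v = ϑ c U v) ∧
          (∀ c U (g : PBond (F.P K) (K - J) → Matrix.specialUnitaryGroup (Fin 2) ℂ), ∀ v ∈ T c U, jd c (extend (iterCentralBond (K - J)) g U) v = jd c U v)) ∧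
          ∀ (c : Summit.QuantumFields.YangMills.Theorems.FluctuationComparisonRegPrIntLWregGlue.WindowChart F hJK
              (histGood F ℰp (θBal F.L γ b₀ p₀) K J) {V : GaugeField (F.P J) 0 (Matrix.specialUnitaryGroup (Fin 2) ℂ) | PlaqSmall (θBal F.L γ b₀ p₀ J) V}),
            (∀ V z, c.jac (V, z) ≠ 0 → ∀ b, (∀ k, iterCentralBond (K - J) k ≠ b) → c.Φ (V, z) b = z b) →
            (∀ V z (h : PBond (F.P K) (K - J) → Matrix.specialUnitaryGroup (Fin 2) ℂ), c.jac (V, extend (iterCentralBond (K - J)) h z) = c.jac (V, z)) →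
            ∀ (V₀ : GaugeField (F.P J) 0 (Matrix.specialUnitaryGroup (Fin 2) ℂ)) (U : GaugeField (F.P K) 0 (Matrix.specialUnitaryGroup (Fin 2) ℂ)),
              PlaqSmall (θBal F.L γ b₀ p₀ J) V₀ → U ∈ histGood F ℰp (θBal F.L γ b₀ p₀) K J → descendTo F ℰp J K hJK U = V₀ →
              {z | c.jac (V₀, z) ≠ 0} ∈ 𝓝 U → c.Φ (V₀, U) = U →
              IsOpen ((Subtype.val : {z | c.jac (V₀, z) ≠ 0} → GaugeField (F.P K) 0 (Matrix.specialUnitaryGroup (Fin 2) ℂ)) ⁻¹'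
                {z | c.Φ (V₀, z) ∈ histGood F ℰp (θBal F.L γ b₀ p₀) K J}) →
              ContinuousOn (fun z => (c.jac (V₀, z) : ℝ)) {z | c.jac (V₀, z) ≠ 0} →
              (c.jac (V₀, U) : ℝ≥0∞) = ∏ c', (jd c' U (Averaging.iter (fun i => BlockAveraging.blockAvg (P := F.P K) (j := i) ℰp) (K - J) U c') : ℝ≥0∞) := by
  intro L b₀ p₀ hb hp
  by_cases hL : 1 ≤ L
  swap
  · refine ⟨1, one_pos, fun F γ hFL _ _ => ?_⟩
    exact absurd (hFL ▸ F.hL.2.le) hL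
  obtain ⟨α, hα0, hα24, hα64, hαF⟩ := exists_chartRegime L hL
  set D₅ : ℝ := ((((3 + 2) * L : ℕ) : ℝ) ^ 2 / 4) with hD₅
  have hD₅0 : 0 ≤ D₅ := by positivity
  set σ : ℝ := α / (D₅ + 1) with hσ
  have hσ0 : 0 < σ := div_pos hα0 (by positivity)
  set δ₀ : ℝ := α / (D₅ + 1 / 2) with hδ₀def
  have hδ₀0 : 0 < δ₀ := div_pos hα0 (by positivity)
  have hσδ : σ < δ₀ := by
    rw [hσ, hδ₀def]
    exact div_lt_div_of_pos_left hα0 (by positivity) (by linarith)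
  have hDδ : D₅ * δ₀ < α := by
    rw [hδ₀def, mul_div_assoc', div_lt_iff₀ (by positivity)]
    nlinarith [hα0]
  obtain ⟨γ₂, hγ₂, hγ₂1, hθσ⟩ := exists_gamma_forall_θBal_le (b₀ := b₀) (p₀ := p₀) hb hp hσ0
  refine ⟨γ₂, hγ₂, fun F γ hFL hγ hγle J K hJK => ?_⟩
  haveI : BorelSpace (GaugeField (F.P K) 0 (Matrix.specialUnitaryGroup (Fin 2) ℂ)) :=
    inferInstanceAs (BorelSpace (PBond (F.P K) 0 → Matrix.specialUnitaryGroup (Fin 2) ℂ))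
  haveI : IsProbabilityMeasure (HaarData.haar (G := Matrix.specialUnitaryGroup (Fin 2) ℂ)) := HaarData.isProb
  have hLF : 1 ≤ F.L := F.hL.2.le
  obtain ⟨hαL, hgap⟩ := hαF F hFL K
  have hγ1 : γ ≤ 1 := hγle.trans hγ₂1
  have hθpos : ∀ i, 0 < θBal F.L γ b₀ p₀ i := fun i => T3MinimiserStabilityReduction.θBal_pos hLF hγ hγ1 hb p₀ i
  have hd : (F.P K).d = 3 := T3Family.P_d F K
  have hLL : (F.P K).L = L := hFL
  have hD₅eq : (((((F.P K).d + 2) * (F.P K).L : ℕ) : ℝ) ^ 2 / 4) = D₅ := by rw [hd, hLL]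
  have hθδ : ∀ i, θBal F.L γ b₀ p₀ i < δ₀ := fun i => (hθσ F.L hLF γ hγ hγle i).trans_lt hσδ
  have hsmall : (((((F.P K).d + 2) * (F.P K).L : ℕ) : ℝ) ^ 2 / 4) * δ₀ ≤ ExpMeanLog.deltaSU (Fin 2) / 2 := by
    rw [hD₅eq]; nlinarith [hDδ, hα64, ExpMeanLog.deltaSU_pos (n := Fin 2)]
  have hD : (((((F.P K).d + 2) * (F.P K).L : ℕ) : ℝ) ^ 2 / 4) * δ₀ < α := by rw [hD₅eq]; exact hDδ
  have hθα : ∀ i, (((((F.P K).d + 2) * (F.P K).L : ℕ) : ℝ) ^ 2 / 4) * θBal F.L γ b₀ p₀ i ≤ α := fun i => by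
    have h5 : (0 : ℝ) ≤ ((((F.P K).d + 2) * (F.P K).L : ℕ) : ℝ) ^ 2 / 4 := by positivity
    exact (mul_le_mul_of_nonneg_left (hθδ i).le h5).trans hD.le
  have hαδ : α < deltaSU (Fin 2) := by nlinarith [ExpMeanLog.deltaSU_pos (n := Fin 2)]
  have hn : K - J ≤ (F.P K).m + (F.P K).K := by
    show K - J ≤ F.m + K
    omega
  have hβ := iterCentralBond_injective (P := F.P K) (n := K - J) hn
  set θ := θBal F.L γ b₀ p₀ with hθdef
  -- CHART-VOL, then the explicit fibred chart WITH ITS PRODUCT JACOBIAN (✓IV-c″)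
  obtain ⟨j₀, hj₀, hvol⟩ := Summit.QuantumFields.YangMills.Theorems.FluctuationComparisonRegPrIntLWreg.chartVol F K α hα0 hα24 hα64 hαL hgap
  obtain ⟨T, ϑ, jd, Φ, Jac, hrows, hΦeq, hJeq, hΦm, hJm, hfibA, hlaw, hTc, hJT, hreg, hdead, hTeq, hcharted, hbdd, hrecog, -, -, -, hTbl, hΦbl, hJbl,
      htransfer⟩ :=
    exists_fibredChart_iter_cont_blind_prod (N := 2) (P := F.P K) hα0.le hα24 hα64 hαL hgap (Or.inr hvol) hn
  refine ⟨α, j₀, T, ϑ, jd, ⟨hα0, hα24, hα64, hαL, hgap, hj₀⟩, hrows, ?_⟩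
  intro c hoff hjbl V₀ U hV₀ hUg hUV hcarr hΦU hrel hcz
  -- the level identification and `descendTo = e ∘ Ū⁽ᴷ⁻ᴶ⁾`
  have hs := F.sitesPerDir_eq (m := F.m) (K := J) (j := 0) (m' := F.m) (K' := K) (j' := K - J) (by omega)
  set e : GaugeField (F.P K) (K - J) (Matrix.specialUnitaryGroup (Fin 2) ℂ) → GaugeField (F.P J) 0 (Matrix.specialUnitaryGroup (Fin 2) ℂ) := fieldShift hs with he_def
  set e' : GaugeField (F.P J) 0 (Matrix.specialUnitaryGroup (Fin 2) ℂ) → GaugeField (F.P K) (K - J) (Matrix.specialUnitaryGroup (Fin 2) ℂ) := fieldShift hs.symm with he'_def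
  have he : Measurable e := measurable_fieldShift hs
  have he' : Measurable e' := measurable_fieldShift hs.symm
  have hee' : ∀ y', e (e' y') = y' := fieldShift_symm_fieldShift hs
  have he'e : ∀ y, e' (e y) = y := fieldShift_fieldShift_symm hs
  have hpres : (fieldMeasure (F.P K) (K - J) (Matrix.specialUnitaryGroup (Fin 2) ℂ)).map e = fieldMeasure (F.P J) 0 (Matrix.specialUnitaryGroup (Fin 2) ℂ) := (measurePreserving_fieldShift hs).map_eq
  have hdesc : (descendTo F ℰp J K hJK : GaugeField (F.P K) 0 (Matrix.specialUnitaryGroup (Fin 2) ℂ) → GaugeField (F.P J) 0 (Matrix.specialUnitaryGroup (Fin 2) ℂ)) =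
      e ∘ Averaging.iter (fun i => BlockAveraging.blockAvg (P := F.P K) (j := i) ℰp) (K - J) := rfl
  have hUV' : Averaging.iter (fun i => BlockAveraging.blockAvg (P := F.P K) (j := i) ℰp) (K - J) U = e' V₀ := by
    have h1 := hUV
    rw [hdesc, Function.comp_apply] at h1
    rw [← h1, he'e]
  -- the sets: `S = histGood`, `Strict` = strict small history, windows
  have hSm : MeasurableSet (histGood F ℰp θ K J) := measurableSet_histGood F ℰp measurableE_ℰp θ K J
  have hSo : IsOpen (histGood F ℰp θ K J) := isOpen_histGood F hδ₀0.le (fun i => (hθδ i).le) hsmall hJK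
  have hSstrict : histGood F ℰp θ K J ⊆ {U | ∀ k, k < K - J → ∀ (c' : PBond (F.P K) (k + 1)) (i : Idx (F.P K)),
      dist1 (loopHol (Averaging.iter (fun i => BlockAveraging.blockAvg (P := F.P K) (j := i) ℰp) k U) c' i) < α} :=
    subset_closure.trans (closure_histGood_subset_loopSmall_lt F hJK hδ₀0.le hθδ hsmall hD)
  have hSwin : histGood F ℰp θ K J ⊆ {U | ∀ c, U (iterCentralBond (K - J) c) ∈ chainWindow (N := 2) α (K - J) U c} :=
    histGood_subset_charted F hJK (fun i => (hθpos i).le) hθα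
  have hO : MeasurableSet {V : GaugeField (F.P J) 0 (Matrix.specialUnitaryGroup (Fin 2) ℂ) | PlaqSmall (θ J) V} := (isOpen_setOf_plaqSmall₂ (F.P J) 0 (θ J)).measurableSet
  have hOo : IsOpen {V : GaugeField (F.P J) 0 (Matrix.specialUnitaryGroup (Fin 2) ℂ) | PlaqSmall (θ J) V} := isOpen_setOf_plaqSmall₂ (F.P J) 0 (θ J)
  -- the explicit side's rows by name
  have hJac' : Measurable fun p => (Jac p : ℝ≥0∞) := hJm.coe_nnreal_ennreal
  have hlaw' := fibredLaw_transport (fieldMeasure (F.P K) 0 (Matrix.specialUnitaryGroup (Fin 2) ℂ)) (fieldMeasure (F.P K) (K - J) (Matrix.specialUnitaryGroup (Fin 2) ℂ)) (fieldMeasure (F.P J) 0 (Matrix.specialUnitaryGroup (Fin 2) ℂ))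
    he he' he'e hpres hΦm hJac' hlaw hSm hSwin hO
  have hedge : ∀ (cc : PBond (F.P K) (K - J)) (v : Matrix.specialUnitaryGroup (Fin 2) ℂ), ∀ᵐ z ∂fieldMeasure (F.P K) 0 (Matrix.specialUnitaryGroup (Fin 2) ℂ), v ∉ frontier (T cc z) := by
    intro cc v
    have h := Summit.QuantumFields.YangMills.Theorems.FluctuationComparisonRegPrIntLWreg.edgeFlat F K (K - J) hn α hα0 hα24 hα64 hαL hgap cc v
    filter_upwards [h] with z hz
    rwa [hTeq cc z]
  have hgraph : ∀ U₀ : GaugeField (F.P K) 0 (Matrix.specialUnitaryGroup (Fin 2) ℂ), U₀ ∈ {U | ∀ k, k < K - J → ∀ (c' : PBond (F.P K) (k + 1)) (i : Idx (F.P K)),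
      dist1 (loopHol (Averaging.iter (fun i => BlockAveraging.blockAvg (P := F.P K) (j := i) ℰp) k U) c' i) < α} →
      {z : GaugeField (F.P K) 0 (Matrix.specialUnitaryGroup (Fin 2) ℂ) | ∀ cc, Averaging.iter (fun i => BlockAveraging.blockAvg (P := F.P K) (j := i) ℰp) (K - J) U₀ cc ∈ T cc z} ∈ 𝓝 U₀ :=
    fun U₀ hstrict => graph_mem_nhds (N := 2) (P := F.P K) hα24 hαδ hαL hn hJT hrecog U₀ hstrict
  have htransfer' : ∀ (V : GaugeField (F.P K) (K - J) (Matrix.specialUnitaryGroup (Fin 2) ℂ)) (z₀ : GaugeField (F.P K) 0 (Matrix.specialUnitaryGroup (Fin 2) ℂ)), (∀ cc, V cc ∈ T cc z₀) →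
      Φ (V, z₀) ∈ {U | ∀ k, k < K - J → ∀ (c' : PBond (F.P K) (k + 1)) (i : Idx (F.P K)),
        dist1 (loopHol (Averaging.iter (fun i => BlockAveraging.blockAvg (P := F.P K) (j := i) ℰp) k U) c' i) < α} →
      ContinuousWithinAt Φ {p : GaugeField (F.P K) (K - J) (Matrix.specialUnitaryGroup (Fin 2) ℂ) × GaugeField (F.P K) 0 (Matrix.specialUnitaryGroup (Fin 2) ℂ) | ∀ cc, p.1 cc ∈ T cc p.2} (V, z₀) ∧
      ContinuousWithinAt Jac {p : GaugeField (F.P K) (K - J) (Matrix.specialUnitaryGroup (Fin 2) ℂ) × GaugeField (F.P K) 0 (Matrix.specialUnitaryGroup (Fin 2) ℂ) | ∀ cc, p.1 cc ∈ T cc p.2} (V, z₀) :=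
    fun V z₀ hV hstrict => htransfer V z₀ hV hstrict
  -- the point `U`: live and self-charted for the explicit chart (recognition with `g :=` the pivots of `U`)
  have hext : extend (iterCentralBond (K - J)) (fun cc => U (iterCentralBond (K - J) cc)) U = U := by
    funext b
    by_cases hb' : ∃ cc, iterCentralBond (K - J) cc = b
    · obtain ⟨cc, rfl⟩ := hb'
      exact hβ.extend_apply _ _ _
    · exact extend_apply' _ _ _ hb'
  have hch : ∀ cc, U (iterCentralBond (K - J) cc) ∈ chainWindow (N := 2) α (K - J) U cc := hSwin hUg
  obtain ⟨hJU, hΦU'⟩ := hrecog (e' V₀) U (fun cc => U (iterCentralBond (K - J) cc)) hch (fun cc => by rw [hext, hUV'])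
  rw [hext] at hΦU'
  -- the knit (✓p764094) and the product (✓p761834)
  have hmain := windowChart_jac_eq_explicit_at F hJK hO hOo c (iterCentralBond (K - J)) hoff hjbl hΦm hJm hfibA hJT hreg hedge
    (fun V z hV => (hcharted V z hV).1) hΦbl hJbl htransfer' hgraph hs hdesc hSm hSo hSstrict hlaw' hV₀ hUg hUV' hJU hΦU' hcarr hΦU hrel hcz
  rw [hmain, jac_apply_eq_prod_of_mem hJeq ((hJT _ _).1 hJU), hUV', ENNReal.ofNNReal_finsetProd]

end Summit.QuantumFields.YangMills.Theorems.FluctuationComparisonRegPrIntLS2BetaChartJacPinnedOfRecord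

end
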